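import Mathlib.Analysis.SpecialFunctions.ImproperIntegrals
import Mathlib.Analysis.Complex.Exponential
import Literature.Analysis.SingularIntegrals.MaximalFunctionDomination
import Literature.Analysis.UnboundedOperators.HeatFlowCalculus
import Literature.Analysis.UnboundedOperators.HeatKernelGaussianData
import HarnessLib

/-!
# Giga's space–time integrability of the free heat flow: `e^{tΔ}a ∈ L⁵(ℝ³ × (0, ∞))` for `a ∈ L³`

Analysis/FluidPDE support file (theorems only, everything proved). It serves the discharge of
the named fact `Literature.Analysis.FluidPDE.ess_kato_L3_local` (`NSLerayHopfProofs.lean`;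
Escauriaza–Seregin–Šverák 2003, Thm. 7.4 / Remark 7.5: Kato's `L³` local theory with the
integrability `u ∈ L₅(Q_T)`), whose `L₅(Q_T)` clause rests on the estimate of the free term
(ESS 2003, Appendix, Lemma 7.1, (7.4) with `s = 5`, `s₁ = 3`, `l = 5`, "due to Giga"; Giga 1986):

  `‖Γ ∗ a‖_{L₅(ℝ³ × (0,∞))} ≤ c ‖a‖_{L₃(ℝ³)}`.

ESS prove it through the energy identity for `|u|^{3/2}`; Giga by Marcinkiewicz interpolation.
Here it is proved by the **maximal function**: for every `x` and `t > 0`,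
`|e^{tΔ}a(x)| ≤ C₁ (M|a|)(x)` (the Gauss–Weierstrass kernel is dominated by
`C t^{-3/2} (1 + |y|/√t)^{-4}`, and such kernels are controlled by the Hardy–Littlewood maximal
function, tree `SingularIntegrals/MaximalFunctionDomination`) and `|e^{tΔ}a(x)| ≤ (4πt)^{-1/2}‖a‖₃`
(Hölder), whence `∫₀^∞ |e^{tΔ}a(x)|⁵ dt ≤ ∫₀^∞ min(A, B t^{-1/2})⁵ dt ≤ 2 A³ B²` with
`A = C₁ (M|a|)(x)`, `B = (4π)^{-1/2}‖a‖₃`, and by Tonelli and the maximal theorem in `L³`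
(`∫ (M|a|)³ ≤ C ∫ |a|³`, tree `SingularIntegrals/HardyLittlewoodMaximal`)
`∫₀^∞ ∫ |e^{tΔ}a|⁵ dx dt ≤ C ‖a‖₃⁵`.

## Main statements

* `lintegral_Ioi_min_pow_five_le` — the one-dimensional integral `∫₀^∞ min(A, B t^{-1/2})⁵ dt ≤ 2A³B²`;
* `enorm_heatExtension_le_maximalFunction` — `‖e^{tΔ}a(x)‖ ≤ C₁ (M‖a‖)(x)` in dimension three;
* `lintegral_lintegral_enorm_heatExtension_pow_five_le` — `∫₀^∞ ∫ ‖e^{tΔ}a‖⁵ ≤ C ‖a‖₃⁵`, and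
  `lintegral_Ioi_eLpNorm_heatExtension_pow_five_le` — the same with the inner integral written
  as `‖e^{tΔ}a‖₅⁵` (Giga's estimate (7.4), `s = 5`, `s₁ = 3`).

## Mathlib / tree search

Tree: `maximalFunction`, `lintegral_maximalFunction_rpow_le` (`SingularIntegrals/HardyLittlewoodMaximal`),
`lintegral_mul_decay_le_maximalFunction` (`SingularIntegrals/MaximalFunctionDomination`),
`heatExtension_apply`, `heatKernel`, `enorm_heatExtension_le` (`UnboundedOperators/HeatKernel`,
`HeatFlowCalculus`); no space–time `L⁵` statement for the heat flow existed
(`lean search 'heatExtension.*five|Giga.*heat'`). Mathlib: `integral_Ioi_rpow_of_lt`,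
`Measure.addHaar_ball_of_pos`, `lintegral_sub_left_eq_self`, `lintegral_lintegral_swap`,
`Real.quadratic_le_exp_of_nonneg`; tree `heatExtension_congr_ae'` (`HeatKernelGaussianData`).

## References

* L. Escauriaza, G. Seregin, V. Šverák, *`L_{3,∞}`-solutions of Navier–Stokes equations and
  backward uniqueness*, Russ. Math. Surveys 58:2 (2003) 211–250 (= IMA preprint 1904), Appendix,
  Lemma 7.1, (7.3)–(7.5), Remark 7.2. [EscauriazaSereginSverak2003]
* Y. Giga, *Solutions for semilinear parabolic equations in `L^p` and regularity of weak
  solutions of the Navier–Stokes system*, J. Differential Equations 62 (1986) 186–212 (the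
  estimate `‖e^{tΔ}a‖_{L^l(0,∞;L^s)} ≤ C‖a‖_{s₁}`). [Giga1986]
* E. M. Stein, *Singular integrals and differentiability properties of functions* (1970),
  Ch. I §1 Thm. 1, Ch. III §2.2 Thm. 2 (a). [Stein1971]
-/

noncomputable section

open MeasureTheory Metric Set Filter Function
open Literature.Analysis.UnboundedOperators Literature.Analysis.SingularIntegrals
open scoped ENNReal NNReal

namespace Literature.Analysis.FluidPDE

/-! ### The one-dimensional integral -/

/-- An elementary bound for the Gaussian: `(1 + ρ)⁴ e^{-ρ²/4} ≤ 512` for `ρ ≥ 0`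
(`ρ ≤ 1`: `≤ 16`; `ρ ≥ 1`: `(2ρ)⁴ · 2/(ρ²/4)² = 512`, from `x²/2 ≤ eˣ`). [folklore] -/
theorem one_add_pow_four_mul_exp_neg_sq_le {ρ : ℝ} (hρ : 0 ≤ ρ) :
    (1 + ρ) ^ 4 * Real.exp (-(ρ ^ 2 / 4)) ≤ 512 := by
  have hexp_le_one : Real.exp (-(ρ ^ 2 / 4)) ≤ 1 :=
    Real.exp_le_one_iff.2 (by nlinarith [sq_nonneg ρ])
  rcases le_or_gt ρ 1 with h1 | h1
  · have h16 : (1 + ρ) ^ 4 ≤ 16 := by nlinarith [pow_le_pow_left₀ (by linarith : (0:ℝ) ≤ 1 + ρ) (by linarith : 1 + ρ ≤ 2) 4]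
    calc (1 + ρ) ^ 4 * Real.exp (-(ρ ^ 2 / 4)) ≤ 16 * 1 :=
          mul_le_mul h16 hexp_le_one (Real.exp_nonneg _) (by norm_num)
      _ ≤ 512 := by norm_num
  · -- `ρ > 1`
    set x : ℝ := ρ ^ 2 / 4 with hx
    have hx0 : 0 < x := by rw [hx]; positivity
    have hq : x ^ 2 / 2 ≤ Real.exp x := by
      have := Real.quadratic_le_exp_of_nonneg hx0.le
      nlinarith
    have hexp : Real.exp (-x) ≤ 2 / x ^ 2 := by
      rw [Real.exp_neg, inv_eq_one_div, div_le_div_iff₀ (Real.exp_pos x) (by positivity)]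
      nlinarith
    have hpow : (1 + ρ) ^ 4 ≤ 16 * ρ ^ 4 := by
      have : 1 + ρ ≤ 2 * ρ := by linarith
      calc (1 + ρ) ^ 4 ≤ (2 * ρ) ^ 4 := pow_le_pow_left₀ (by linarith) this 4
        _ = 16 * ρ ^ 4 := by ring
    have hx2 : x ^ 2 = ρ ^ 4 / 16 := by rw [hx]; ring
    calc (1 + ρ) ^ 4 * Real.exp (-x) ≤ 16 * ρ ^ 4 * (2 / x ^ 2) :=
          mul_le_mul hpow hexp (Real.exp_nonneg _) (by positivity)
      _ = 512 := by
          rw [hx2]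
          have hρ4 : ρ ^ 4 ≠ 0 := by positivity
          field_simp
          ring

/-- **The one-dimensional integral** behind the maximal-function proof of Giga's estimate:
for `A, B ∈ [0, ∞]`, `∫₀^∞ min(A, B t^{-1/2})⁵ dt ≤ 2 A³ B²` (split at `t₀ = (B/A)²`:
`A⁵ t₀ + B⁵ ∫_{t₀}^∞ t^{-5/2} dt = A³B² + (2/3) A³B²`). [folklore] -/
theorem lintegral_Ioi_min_pow_five_le (A B : ℝ≥0∞) :
    ∫⁻ t in Ioi (0 : ℝ), (min A (B * ENNReal.ofReal (t ^ (-(1 / 2 : ℝ))))) ^ 5 ≤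
      2 * A ^ 3 * B ^ 2 := by
  -- degenerate cases
  by_cases hA0 : A = 0
  · simp [hA0]
  by_cases hB0 : B = 0
  · simp [hB0]
  by_cases hAt : A = ⊤
  · rw [hAt, ENNReal.top_pow (by norm_num), ENNReal.mul_top two_ne_zero,
      ENNReal.top_mul (pow_ne_zero 2 hB0)]
    exact le_top
  by_cases hBt : B = ⊤
  · rw [hBt, ENNReal.top_pow (by norm_num), ENNReal.mul_top (mul_ne_zero two_ne_zero (pow_ne_zero 3 hA0))]
    exact le_top
  -- the main case: `A = a`, `B = b` positive reals
  set a : ℝ := A.toReal with ha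
  set b : ℝ := B.toReal with hb
  have ha0 : 0 < a := ENNReal.toReal_pos hA0 hAt
  have hb0 : 0 < b := ENNReal.toReal_pos hB0 hBt
  have hAa : A = ENNReal.ofReal a := (ENNReal.ofReal_toReal hAt).symm
  have hBb : B = ENNReal.ofReal b := (ENNReal.ofReal_toReal hBt).symm
  set t₀ : ℝ := (b / a) ^ 2 with ht₀
  have ht₀0 : 0 < t₀ := by positivity
  -- split the half-line at `t₀`
  have hsplit : Ioi (0 : ℝ) = Ioc 0 t₀ ∪ Ioi t₀ := (Ioc_union_Ioi_eq_Ioi ht₀0.le).symm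
  have h1 : ∫⁻ t in Ioc (0 : ℝ) t₀, (min A (B * ENNReal.ofReal (t ^ (-(1 / 2 : ℝ))))) ^ 5 ≤
      ENNReal.ofReal (a ^ 3 * b ^ 2) := by
    calc ∫⁻ t in Ioc (0 : ℝ) t₀, (min A (B * ENNReal.ofReal (t ^ (-(1 / 2 : ℝ))))) ^ 5
        ≤ ∫⁻ _ in Ioc (0 : ℝ) t₀, A ^ 5 := lintegral_mono fun t => by gcongr; exact min_le_left _ _
      _ = A ^ 5 * ENNReal.ofReal t₀ := by
          rw [setLIntegral_const, Real.volume_Ioc, sub_zero, mul_comm]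
      _ = ENNReal.ofReal (a ^ 3 * b ^ 2) := by
          rw [hAa, ← ENNReal.ofReal_pow ha0.le, ← ENNReal.ofReal_mul (by positivity)]
          congr 1
          rw [ht₀]
          field_simp
  have h2 : ∫⁻ t in Ioi t₀, (min A (B * ENNReal.ofReal (t ^ (-(1 / 2 : ℝ))))) ^ 5 ≤
      ENNReal.ofReal (2 / 3 * (a ^ 3 * b ^ 2)) := by
    have hpt : ∀ t ∈ Ioi t₀, (min A (B * ENNReal.ofReal (t ^ (-(1 / 2 : ℝ))))) ^ 5 ≤
        ENNReal.ofReal (b ^ 5) * ENNReal.ofReal (t ^ (-(5 / 2 : ℝ))) := by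
      intro t ht
      have ht0 : 0 < t := ht₀0.trans ht
      calc (min A (B * ENNReal.ofReal (t ^ (-(1 / 2 : ℝ))))) ^ 5
          ≤ (B * ENNReal.ofReal (t ^ (-(1 / 2 : ℝ)))) ^ 5 := by gcongr; exact min_le_right _ _
        _ = ENNReal.ofReal (b ^ 5) * ENNReal.ofReal (t ^ (-(5 / 2 : ℝ))) := by
            rw [mul_pow, hBb, ← ENNReal.ofReal_pow hb0.le, ← ENNReal.ofReal_pow (Real.rpow_nonneg ht0.le _),
              ← Real.rpow_natCast (t ^ (-(1 / 2 : ℝ))) 5, ← Real.rpow_mul ht0.le]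
            norm_num
    have hint : IntegrableOn (fun t : ℝ => t ^ (-(5 / 2 : ℝ))) (Ioi t₀) volume :=
      integrableOn_Ioi_rpow_of_lt (by norm_num) ht₀0
    calc ∫⁻ t in Ioi t₀, (min A (B * ENNReal.ofReal (t ^ (-(1 / 2 : ℝ))))) ^ 5
        ≤ ∫⁻ t in Ioi t₀, ENNReal.ofReal (b ^ 5) * ENNReal.ofReal (t ^ (-(5 / 2 : ℝ))) :=
          setLIntegral_mono' measurableSet_Ioi hpt
      _ = ENNReal.ofReal (b ^ 5) * ENNReal.ofReal (∫ t in Ioi t₀, t ^ (-(5 / 2 : ℝ))) := by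
          rw [lintegral_const_mul' _ _ ENNReal.ofReal_ne_top,
            ofReal_integral_eq_lintegral_ofReal hint
              ((ae_restrict_iff' measurableSet_Ioi).2 (Eventually.of_forall fun t ht =>
                Real.rpow_nonneg (ht₀0.trans ht).le _))]
      _ = ENNReal.ofReal (2 / 3 * (a ^ 3 * b ^ 2)) := by
          rw [integral_Ioi_rpow_of_lt (by norm_num) ht₀0, ← ENNReal.ofReal_mul (by positivity)]
          congr 1
          have h32 : t₀ ^ (-(5 / 2 : ℝ) + 1) = (b / a) ^ (-(3 : ℝ)) := by
            rw [ht₀, ← Real.rpow_natCast (b / a) 2, ← Real.rpow_mul (by positivity)]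
            norm_num
          rw [h32, Real.rpow_neg (by positivity), Real.rpow_ofNat,
            show (-(5 / 2 : ℝ) + 1) = -(3 / 2) by norm_num]
          field_simp
  calc ∫⁻ t in Ioi (0 : ℝ), (min A (B * ENNReal.ofReal (t ^ (-(1 / 2 : ℝ))))) ^ 5
      ≤ (∫⁻ t in Ioc (0 : ℝ) t₀, (min A (B * ENNReal.ofReal (t ^ (-(1 / 2 : ℝ))))) ^ 5) +
          ∫⁻ t in Ioi t₀, (min A (B * ENNReal.ofReal (t ^ (-(1 / 2 : ℝ))))) ^ 5 := by
        rw [hsplit]; exact lintegral_union_le _ _ _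
    _ ≤ ENNReal.ofReal (a ^ 3 * b ^ 2) + ENNReal.ofReal (2 / 3 * (a ^ 3 * b ^ 2)) := add_le_add h1 h2
    _ = ENNReal.ofReal (5 / 3 * (a ^ 3 * b ^ 2)) := by
        rw [← ENNReal.ofReal_add (by positivity) (by positivity)]; congr 1; ring
    _ ≤ ENNReal.ofReal (2 * (a ^ 3 * b ^ 2)) := ENNReal.ofReal_le_ofReal (by nlinarith [mul_pos (pow_pos ha0 3) (pow_pos hb0 2)])
    _ = 2 * A ^ 3 * B ^ 2 := by
        rw [hAa, hBb, ENNReal.ofReal_mul (by norm_num), ENNReal.ofReal_mul (by positivity),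
          ENNReal.ofReal_pow ha0.le, ENNReal.ofReal_pow hb0.le, ENNReal.ofReal_ofNat, mul_assoc]

/-! ### The heat flow is dominated by the maximal function -/

variable {E : Type*} [NormedAddCommGroup E] [InnerProductSpace ℝ E] [FiniteDimensional ℝ E]
  [MeasurableSpace E] [BorelSpace E]
variable {F : Type*} [NormedAddCommGroup F] [NormedSpace ℝ F]

omit [FiniteDimensional ℝ E] [MeasurableSpace E] [BorelSpace E] in
/-- **Domination of the Gauss–Weierstrass kernel** in dimension three:
`Γ(t, y) ≤ 512 (4πt)^{-3/2} (1 + |y|/√t)^{-4}` for `t > 0`. [folklore] -/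
theorem heatKernel_le_decay (hE : Module.finrank ℝ E = 3) {t : ℝ} (ht : 0 < t) (y : E) :
    heatKernel t y ≤ 512 * (4 * Real.pi * t) ^ (-(3 / 2 : ℝ)) * ((1 + ‖y‖ / Real.sqrt t) ^ 4)⁻¹ := by
  have hst : 0 < Real.sqrt t := Real.sqrt_pos.2 ht
  set ρ : ℝ := ‖y‖ / Real.sqrt t with hρ
  have hρ0 : 0 ≤ ρ := by positivity
  have hρ2 : ‖y‖ ^ 2 / (4 * t) = ρ ^ 2 / 4 := by
    rw [hρ, div_pow, Real.sq_sqrt ht.le]; ring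
  have h1ρ : 0 < (1 + ρ) ^ 4 := by positivity
  have hmain := one_add_pow_four_mul_exp_neg_sq_le hρ0
  have hexp : Real.exp (-(ρ ^ 2 / 4)) ≤ 512 * ((1 + ρ) ^ 4)⁻¹ := by
    rw [← div_eq_mul_inv, le_div_iff₀ h1ρ, mul_comm]
    exact hmain
  unfold heatKernel
  rw [hE, show (-((3 : ℕ) : ℝ) / 2) = -(3 / 2 : ℝ) by norm_num, neg_div, hρ2]
  have hc : 0 ≤ (4 * Real.pi * t) ^ (-(3 / 2 : ℝ)) := Real.rpow_nonneg (by positivity) _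
  calc (4 * Real.pi * t) ^ (-(3 / 2 : ℝ)) * Real.exp (-(ρ ^ 2 / 4))
      ≤ (4 * Real.pi * t) ^ (-(3 / 2 : ℝ)) * (512 * ((1 + ρ) ^ 4)⁻¹) :=
        mul_le_mul_of_nonneg_left hexp hc
    _ = 512 * (4 * Real.pi * t) ^ (-(3 / 2 : ℝ)) * ((1 + ρ) ^ 4)⁻¹ := by ring

/-- The caloric extension is bounded by the Gauss–Weierstrass average of the size of the data:
`‖e^{tΔ}a(x)‖ ≤ ∫ Γ(t, x - z) ‖a(z)‖ dz` (norm of the Bochner integral, then the substitution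
`z = x - y`). [folklore] -/
theorem enorm_heatExtension_le_lintegral_heatKernel_sub (a : E → F) {t : ℝ} (ht : 0 < t) (x : E) :
    ‖heatExtension a t x‖ₑ ≤ ∫⁻ z, ENNReal.ofReal (heatKernel t (x - z)) * ‖a z‖ₑ := by
  rw [heatExtension_apply]
  calc ‖∫ y, heatKernel t y • a (x - y)‖ₑ ≤ ∫⁻ y, ‖heatKernel t y • a (x - y)‖ₑ :=
        enorm_integral_le_lintegral_enorm _
    _ = ∫⁻ y, ENNReal.ofReal (heatKernel t y) * ‖a (x - y)‖ₑ := by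
        refine lintegral_congr fun y => ?_
        rw [enorm_smul, Real.enorm_eq_ofReal (heatKernel_pos ht y).le]
    _ = ∫⁻ z, ENNReal.ofReal (heatKernel t (x - z)) * ‖a z‖ₑ := by
        rw [← lintegral_sub_left_eq_self (fun z => ENNReal.ofReal (heatKernel t (x - z)) * ‖a z‖ₑ) x]
        simp only [sub_sub_cancel]

/-- **The heat flow is dominated by the Hardy–Littlewood maximal function** (Stein 1970,
Ch. III §2.2 Thm. 2 (a), for the Gauss–Weierstrass kernel in dimension three): for every `t > 0`
and every `x`, `‖e^{tΔ}a(x)‖ ≤ C₁ (M‖a‖)(x)` with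
`C₁ = 512 (4π)^{-3/2} · 2⁵ · |B(0,1)|`, independent of `t`. [cite: Stein1971, Ch. III §2.2 Thm 2 (a)] -/
theorem enorm_heatExtension_le_maximalFunction (hE : Module.finrank ℝ E = 3) {a : E → F}
    (ha : AEStronglyMeasurable a volume) {t : ℝ} (ht : 0 < t) (x : E) :
    ‖heatExtension a t x‖ₑ ≤
      ENNReal.ofReal (512 * (4 * Real.pi) ^ (-(3 / 2 : ℝ))) * 2 ^ 5 * volume (ball (0 : E) 1) *
        maximalFunction volume (fun z => ‖a z‖ₑ) x := by
  have hst : 0 < Real.sqrt t := Real.sqrt_pos.2 ht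
  have hF : AEMeasurable (fun z => ‖a z‖ₑ) volume := ha.enorm
  -- the domination lemma, exponent `finrank + 1 = 4`
  have hdom := lintegral_mul_decay_le_maximalFunction volume hF x hst
  rw [hE] at hdom
  -- the kernel bound
  have hker : ∀ z, ENNReal.ofReal (heatKernel t (x - z)) * ‖a z‖ₑ ≤
      ENNReal.ofReal (512 * (4 * Real.pi * t) ^ (-(3 / 2 : ℝ))) *
        (‖a z‖ₑ * ENNReal.ofReal (((1 + ‖x - z‖ / Real.sqrt t) ^ (3 + 1))⁻¹)) := by
    intro z
    have h := heatKernel_le_decay hE ht (x - z)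
    calc ENNReal.ofReal (heatKernel t (x - z)) * ‖a z‖ₑ
        ≤ ENNReal.ofReal (512 * (4 * Real.pi * t) ^ (-(3 / 2 : ℝ)) *
            ((1 + ‖x - z‖ / Real.sqrt t) ^ 4)⁻¹) * ‖a z‖ₑ := by gcongr
      _ = _ := by
          rw [ENNReal.ofReal_mul (by positivity)]
          ring
  -- the volume of the ball of radius `√t`
  have hball : volume (ball x (Real.sqrt t)) = ENNReal.ofReal (t ^ (3 / 2 : ℝ)) * volume (ball (0 : E) 1) := by
    rw [Measure.addHaar_ball_of_pos volume x hst, hE, Real.sqrt_eq_rpow, ← Real.rpow_natCast,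
      ← Real.rpow_mul ht.le]
    norm_num
  -- `t^{-3/2} · t^{3/2} = 1`
  have hcancel : ENNReal.ofReal (512 * (4 * Real.pi * t) ^ (-(3 / 2 : ℝ))) * ENNReal.ofReal (t ^ (3 / 2 : ℝ)) =
      ENNReal.ofReal (512 * (4 * Real.pi) ^ (-(3 / 2 : ℝ))) := by
    rw [← ENNReal.ofReal_mul (by positivity)]
    congr 1
    rw [Real.mul_rpow (by positivity) ht.le, mul_assoc, mul_assoc, ← Real.rpow_add ht]
    norm_num
  calc ‖heatExtension a t x‖ₑ ≤ ∫⁻ z, ENNReal.ofReal (heatKernel t (x - z)) * ‖a z‖ₑ :=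
        enorm_heatExtension_le_lintegral_heatKernel_sub a ht x
    _ ≤ ∫⁻ z, ENNReal.ofReal (512 * (4 * Real.pi * t) ^ (-(3 / 2 : ℝ))) *
          (‖a z‖ₑ * ENNReal.ofReal (((1 + ‖x - z‖ / Real.sqrt t) ^ (3 + 1))⁻¹)) := lintegral_mono hker
    _ = ENNReal.ofReal (512 * (4 * Real.pi * t) ^ (-(3 / 2 : ℝ))) *
          ∫⁻ z, ‖a z‖ₑ * ENNReal.ofReal (((1 + ‖x - z‖ / Real.sqrt t) ^ (3 + 1))⁻¹) :=
        lintegral_const_mul' _ _ ENNReal.ofReal_ne_top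
    _ ≤ ENNReal.ofReal (512 * (4 * Real.pi * t) ^ (-(3 / 2 : ℝ))) *
          (2 ^ (3 + 2) * volume (ball x (Real.sqrt t)) * maximalFunction volume (fun z => ‖a z‖ₑ) x) := by
        gcongr
    _ = ENNReal.ofReal (512 * (4 * Real.pi) ^ (-(3 / 2 : ℝ))) * 2 ^ 5 * volume (ball (0 : E) 1) *
          maximalFunction volume (fun z => ‖a z‖ₑ) x := by
        rw [hball, ← hcancel]
        ring

/-- The pointwise `L³ → L^∞` decay of the heat flow in dimension three, in the form used here:
`‖e^{tΔ}a(x)‖ ≤ (4π)^{-1/2} ‖a‖₃ · t^{-1/2}` (Hölder; tree `enorm_heatExtension_le`). [folklore] -/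
theorem enorm_heatExtension_le_rpow_neg_half (hE : Module.finrank ℝ E = 3) {a : E → F}
    (ha : MemLp a 3 volume) {t : ℝ} (ht : 0 < t) (x : E) :
    ‖heatExtension a t x‖ₑ ≤
      ENNReal.ofReal ((4 * Real.pi) ^ (-(1 / 2 : ℝ))) * eLpNorm a 3 volume *
        ENNReal.ofReal (t ^ (-(1 / 2 : ℝ))) := by
  have h := enorm_heatExtension_le ha (by norm_num) ht x
  rw [hE] at h
  have hexp : ENNReal.ofReal ((4 * Real.pi * t) ^ (-((3 : ℕ) : ℝ) / 2)) ^ (3 : ℝ≥0∞)⁻¹.toReal =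
      ENNReal.ofReal ((4 * Real.pi) ^ (-(1 / 2 : ℝ))) * ENNReal.ofReal (t ^ (-(1 / 2 : ℝ))) := by
    rw [ENNReal.toReal_inv, ENNReal.toReal_ofNat,
      ENNReal.ofReal_rpow_of_nonneg (Real.rpow_nonneg (by positivity) _) (by norm_num),
      ← Real.rpow_mul (by positivity), ← ENNReal.ofReal_mul (Real.rpow_nonneg (by positivity) _),
      ← Real.mul_rpow (by positivity) ht.le]
    norm_num
  rw [hexp] at h
  calc ‖heatExtension a t x‖ₑ
      ≤ ENNReal.ofReal ((4 * Real.pi) ^ (-(1 / 2 : ℝ))) * ENNReal.ofReal (t ^ (-(1 / 2 : ℝ))) *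
          eLpNorm a 3 volume := h
    _ = _ := by ring

/-! ### Joint measurability -/

/-- **Joint measurability of the caloric extension** `(t, x) ↦ e^{tΔ}a(x)` of a strongly
measurable field (Fubini measurability of the convolution integral). [folklore] -/
theorem stronglyMeasurable_uncurry_heatExtension {a : E → F} (ha : StronglyMeasurable a) :
    StronglyMeasurable (fun q : ℝ × E => heatExtension a q.1 q.2) := by
  have hint : StronglyMeasurable (uncurry fun (q : ℝ × E) (y : E) => heatKernel q.1 y • a (q.2 - y)) := by
    have hK0 : Measurable (fun p : ℝ × E => heatKernel p.1 p.2) := by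
      unfold heatKernel
      fun_prop
    have hK : Measurable (fun p : (ℝ × E) × E => heatKernel p.1.1 p.2) :=
      hK0.comp (measurable_fst.fst.prodMk measurable_snd)
    exact hK.stronglyMeasurable.smul (ha.comp_measurable (measurable_fst.snd.sub measurable_snd))
  have h1 := hint.integral_prod_right' (ν := (volume : Measure E))
  have heq : (fun q : ℝ × E => heatExtension a q.1 q.2) =
      fun q : ℝ × E => ∫ y, heatKernel q.1 y • a (q.2 - y) := by
    funext q
    rw [heatExtension_apply]
  rw [heq]
  exact h1

/-! ### Giga's estimate -/

omit [NormedSpace ℝ F] in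
/-- `‖f‖ₙⁿ = ∫ ‖f‖ⁿ` for a natural number `n ≠ 0` (natural-number powers; private copy of the
tree's `eLpNorm_natCast_pow_eq_lintegral`, `LerayHopfProofs`). [folklore] -/
private theorem eLpNorm_natPow_eq_lintegral {α : Type*} {_ : MeasurableSpace α} (μ : Measure α)
    (f : α → F) {n : ℕ} (hn : n ≠ 0) :
    eLpNorm f n μ ^ n = ∫⁻ x, ‖f x‖ₑ ^ n ∂μ := by
  have h := eLpNorm_nnreal_pow_eq_lintegral (f := f) (μ := μ) (p := (n : ℝ≥0)) (by exact_mod_cast hn)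
  simp only [ENNReal.coe_natCast, NNReal.coe_natCast, ENNReal.rpow_natCast] at h
  exact h

omit [NormedSpace ℝ F] in
/-- `‖f‖₅⁵ = ∫ ‖f‖⁵` (natural-number power). [folklore] -/
theorem eLpNorm_five_pow_five_eq_lintegral {α : Type*} {_ : MeasurableSpace α} (μ : Measure α) (f : α → F) :
    eLpNorm f 5 μ ^ 5 = ∫⁻ x, ‖f x‖ₑ ^ 5 ∂μ := by
  have h := eLpNorm_natPow_eq_lintegral μ f (n := 5) (by norm_num)
  simp only [Nat.cast_ofNat] at h
  exact h

/-- **Giga's estimate, double-integral form** (ESS 2003, Lemma 7.1 (7.4) with `s = 5`, `s₁ = 3`;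
Giga 1986): for `a ∈ L³` on a three-dimensional space,
`∫₀^∞ ∫ ‖e^{tΔ}a(x)‖⁵ dx dt ≤ C ‖a‖₃⁵` with `C` depending only on the space (through the
maximal constant and `|B(0,1)|`). Proof: Tonelli, the pointwise bound
`‖e^{tΔ}a(x)‖ ≤ min(C₁ M‖a‖(x), (4π)^{-1/2}‖a‖₃ t^{-1/2})`, the one-dimensional integral
`lintegral_Ioi_min_pow_five_le`, and the maximal theorem in `L³`. [cite: EscauriazaSereginSverak2003, Lemma 7.1 (7.4)] -/
theorem lintegral_lintegral_enorm_heatExtension_pow_five_le (hE : Module.finrank ℝ E = 3) :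
    ∃ C : ℝ≥0∞, C < ⊤ ∧ ∀ {a : E → F}, MemLp a 3 volume →
      ∫⁻ t in Ioi (0 : ℝ), ∫⁻ x, ‖heatExtension a t x‖ₑ ^ 5 ≤ C * eLpNorm a 3 volume ^ 5 := by
  -- constants
  set C₁ : ℝ≥0∞ := ENNReal.ofReal (512 * (4 * Real.pi) ^ (-(3 / 2 : ℝ))) * 2 ^ 5 * volume (ball (0 : E) 1)
    with hC₁
  set C₂ : ℝ≥0∞ := ENNReal.ofReal ((4 * Real.pi) ^ (-(1 / 2 : ℝ))) with hC₂
  set CM : ℝ≥0∞ := ENNReal.ofReal 3 * (2 * 5 ^ Module.finrank ℝ E) *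
      ((2 : ℝ≥0∞) ^ ((3 : ℝ) - 1) / ENNReal.ofReal ((3 : ℝ) - 1)) with hCM
  have hC₁t : C₁ < ⊤ := by
    rw [hC₁]
    exact ENNReal.mul_lt_top (ENNReal.mul_lt_top ENNReal.ofReal_lt_top (ENNReal.pow_lt_top ENNReal.ofNat_lt_top))
      measure_ball_lt_top
  have hCMt : CM < ⊤ := by
    rw [hCM]
    refine ENNReal.mul_lt_top (ENNReal.mul_lt_top ENNReal.ofReal_lt_top ?_) ?_
    · exact ENNReal.mul_lt_top ENNReal.ofNat_lt_top (ENNReal.pow_lt_top ENNReal.ofNat_lt_top)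
    · refine ENNReal.div_lt_top (ENNReal.rpow_ne_top_of_nonneg (by norm_num) ENNReal.ofNat_ne_top) ?_
      exact (ENNReal.ofReal_pos.2 (by norm_num)).ne'
  refine ⟨2 * C₁ ^ 3 * C₂ ^ 2 * CM, ?_, fun {a} ha => ?_⟩
  · exact ENNReal.mul_lt_top (ENNReal.mul_lt_top (ENNReal.mul_lt_top ENNReal.ofNat_lt_top
      (ENNReal.pow_lt_top hC₁t)) (ENNReal.pow_lt_top ENNReal.ofReal_lt_top)) hCMt
  -- reduce to a strongly measurable representative
  set b : E → F := ha.1.mk a with hb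
  have hbm : StronglyMeasurable b := ha.1.stronglyMeasurable_mk
  have hab : a =ᵐ[volume] b := ha.1.ae_eq_mk
  have hb3 : MemLp b 3 volume := ha.ae_eq hab
  have hext : ∀ t, heatExtension a t = heatExtension b t := fun t => heatExtension_congr_ae' hab t
  have hnorm : eLpNorm b 3 volume = eLpNorm a 3 volume := (eLpNorm_congr_ae hab).symm
  -- Tonelli
  have hmeas : AEMeasurable (uncurry fun (t : ℝ) (x : E) => ‖heatExtension b t x‖ₑ ^ 5)
      ((volume.restrict (Ioi (0 : ℝ))).prod volume) :=
    ((stronglyMeasurable_uncurry_heatExtension hbm).aestronglyMeasurable.enorm.pow_const 5)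
  have hswap := lintegral_lintegral_swap (μ := volume.restrict (Ioi (0 : ℝ))) (ν := (volume : Measure E)) hmeas
  simp_rw [hext]
  rw [hswap]
  -- the pointwise-in-`x` bound of the time integral
  set M : E → ℝ≥0∞ := maximalFunction volume (fun z => ‖b z‖ₑ) with hM
  have hx : ∀ x, ∫⁻ t in Ioi (0 : ℝ), ‖heatExtension b t x‖ₑ ^ 5 ≤
      2 * (C₁ * M x) ^ 3 * (C₂ * eLpNorm b 3 volume) ^ 2 := by
    intro x
    refine le_trans (setLIntegral_mono' measurableSet_Ioi fun t ht => ?_)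
      (lintegral_Ioi_min_pow_five_le (C₁ * M x) (C₂ * eLpNorm b 3 volume))
    gcongr
    exact le_min (enorm_heatExtension_le_maximalFunction hE hbm.aestronglyMeasurable ht x)
      (enorm_heatExtension_le_rpow_neg_half hE hb3 ht x)
  -- the maximal theorem in `L³`
  have hHL : ∫⁻ x, M x ^ 3 ≤ CM * eLpNorm b 3 volume ^ 3 := by
    have h := lintegral_maximalFunction_rpow_le volume (F := fun z => ‖b z‖ₑ)
      hbm.aestronglyMeasurable.enorm (p := 3) (by norm_num)
    have h3 := eLpNorm_natPow_eq_lintegral (volume : Measure E) b (n := 3) (by norm_num)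
    simp only [Nat.cast_ofNat] at h3
    have hl : ∫⁻ x, M x ^ 3 = ∫⁻ x, maximalFunction volume (fun z => ‖b z‖ₑ) x ^ (3 : ℝ) :=
      lintegral_congr fun x => by rw [hM, ← ENNReal.rpow_natCast]; norm_num
    have hr : ∫⁻ z, ‖b z‖ₑ ^ (3 : ℝ) = eLpNorm b 3 volume ^ 3 := by
      rw [h3]; exact lintegral_congr fun z => by rw [← ENNReal.rpow_natCast]; norm_num
    rw [hl, hCM, ← hr]
    exact h
  calc ∫⁻ x, ∫⁻ t in Ioi (0 : ℝ), ‖heatExtension b t x‖ₑ ^ 5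
      ≤ ∫⁻ x, 2 * (C₁ * M x) ^ 3 * (C₂ * eLpNorm b 3 volume) ^ 2 := lintegral_mono hx
    _ = 2 * C₁ ^ 3 * C₂ ^ 2 * eLpNorm b 3 volume ^ 2 * ∫⁻ x, M x ^ 3 := by
        rw [← lintegral_const_mul' _ _ ?_]
        · refine lintegral_congr fun x => ?_; ring
        · refine ENNReal.mul_ne_top (ENNReal.mul_ne_top (ENNReal.mul_ne_top ENNReal.ofNat_ne_top
            (ENNReal.pow_ne_top hC₁t.ne)) (ENNReal.pow_ne_top ENNReal.ofReal_ne_top)) (ENNReal.pow_ne_top hb3.2.ne)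
    _ ≤ 2 * C₁ ^ 3 * C₂ ^ 2 * eLpNorm b 3 volume ^ 2 * (CM * eLpNorm b 3 volume ^ 3) := by gcongr
    _ = 2 * C₁ ^ 3 * C₂ ^ 2 * CM * eLpNorm a 3 volume ^ 5 := by rw [hnorm]; ring

/-- **Giga's estimate** (ESS 2003, Lemma 7.1 (7.4), `s = 5`, `s₁ = 3`, `l = 5`; Remark 7.2 "due to
Giga"; Giga 1986): the free heat flow of an `L³` field on a three-dimensional space lies in
`L⁵(ℝ³ × (0, ∞))`, `∫₀^∞ ‖e^{tΔ}a‖₅⁵ dt ≤ C ‖a‖₃⁵ < ∞`. [cite: EscauriazaSereginSverak2003, Lemma 7.1 (7.4)] -/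
theorem lintegral_Ioi_eLpNorm_heatExtension_pow_five_le (hE : Module.finrank ℝ E = 3) :
    ∃ C : ℝ≥0∞, C < ⊤ ∧ ∀ {a : E → F}, MemLp a 3 volume →
      ∫⁻ t in Ioi (0 : ℝ), eLpNorm (heatExtension a t) 5 volume ^ 5 ≤ C * eLpNorm a 3 volume ^ 5 := by
  obtain ⟨C, hC, h⟩ := lintegral_lintegral_enorm_heatExtension_pow_five_le (E := E) (F := F) hE
  refine ⟨C, hC, fun {a} ha => ?_⟩
  simp_rw [eLpNorm_five_pow_five_eq_lintegral]
  exact h ha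

/-- Giga's estimate, finiteness form: for `a ∈ L³`, `∫₀^∞ ‖e^{tΔ}a‖₅⁵ dt < ∞`. [cite: EscauriazaSereginSverak2003, Lemma 7.1 (7.4)] -/
theorem lintegral_Ioi_eLpNorm_heatExtension_pow_five_lt_top (hE : Module.finrank ℝ E = 3) {a : E → F}
    (ha : MemLp a 3 volume) :
    ∫⁻ t in Ioi (0 : ℝ), eLpNorm (heatExtension a t) 5 volume ^ 5 < ⊤ := by
  obtain ⟨C, hC, h⟩ := lintegral_Ioi_eLpNorm_heatExtension_pow_five_le (E := E) (F := F) hE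
  exact (h ha).trans_lt (ENNReal.mul_lt_top hC (ENNReal.pow_lt_top ha.2))

end Literature.Analysis.FluidPDE
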